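import Summits.HodgeConjecture.HodgeConjecture.Theorems.R90S10ArchTransferSignsOfArchKit   -- ★ S10 kit: `hasArchOpTrace_of_areUnitarilyEquivalent` (the trace is a class function)
import Summits.HodgeConjecture.HodgeConjecture.Theorems.R90S2TensorRepLetterDefs          -- ★ p864621 ℓ3: `piPure`, `HasLocalComponents` (+ `.hasArchOpTrace_zero_of_place`), `TensorRepExhausts`, `TensorRepUnique`
import Summits.HodgeConjecture.HodgeConjecture.Theorems.R90S2ArchBlockPairLetterDefs       -- ★ ℓ1 (R90-C11-typ2): `BlockPairData`
import Summits.HodgeConjecture.HodgeConjecture.Theorems.R90S2ArchBlockPacketLetterDefs     -- ★ ℓ1′ (R90-C11-typ2): `BlockPacketData β` (full local packets; ED. 2)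
import HarnessLib

/-!
# R90-TF ∕ S2 «Ch. 12 archimedean block» — `R90S2ArchTensorPacketExhaust` (CARD 8 sub-brick, step (d)): a tensor of block-pair pseudo-coefficients has
# trace `0` on every irreducible unitary representation of `Γ ≅ ∏_i G_i` OUTSIDE the tensor packet

Cell `pub/hodgecm-mathlib`, Track B ∕ R90-TF, section S2, crux h413 = `stmt-HodgeConjecture-24833`, route `HCCMUnconditional`.  Prover K2E4-p23 (g4) on S2 desk
K2E1b-plan (g8)'s word 2026-09-05T02:47:25Z (2) («free cycles: the step-(d) lemma for K2E3-p25 (g5)'s assembly CARD 8, in your own small file»); GENERIC in ★ ℓ3's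
frame (`e : Γ ≃ₜ* ∏_i G_i`, measures `νΓ`, `ν i`), so that the assembly instantiates it at `Γ = U(Φ₃)(L ⊗ ℝ)`, `e = archPiEquivCM` and rewrites ★ `archTensor_eq_piPure`.

PRINT → DECL (Rogawski 1990 §13.8, proof of Prop. 13.8.3, p. 218 L17–19 and L27–28: «`Tr π(f) = 0` for irreducible `π` not of the form `⊗_v π_{j_v v}`», read through
the external-tensor-product letters ℓ3-B ∕ ℓ3-U and the one-place clause «`Tr(π(f_v)) = 0` for `π ≠ π_{1v}, π_{2v}`» of the block-pair data ℓ1):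
* `hasArchOpTrace_piPure_zero_of_not_matched` — given block-pair data `d i` at every factor (★ ℓ1 `BlockPairData`: two inequivalent irreducible unitary members
  `(d i).π b`, dual pseudo-coefficients `(d i).φ b`, vanishing `hvan` off the pair) and, for every `k : ι → Bool`, an irreducible unitary `ϖ k` of `Γ` with local
  components `(d i).π (k i)` (★ ℓ3 `HasLocalComponents`), every irreducible unitary `σ` of `Γ` unitarily equivalent to NO `ϖ k` has trace `0` on every pure tensor
  `⊗_i (d i).φ (k i)` — under the letters ★ `TensorRepExhausts` (ℓ3-B: `σ` has irreducible unitary local components `π′_i`) and ★ `TensorRepUnique` (ℓ3-U):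
  if every `π′_i` were equivalent to a member `(d i).π (b i)` then `σ ≃ ϖ b` (ℓ3-U) — excluded; so at some `i₀` the component `π′_{i₀}` is off the pair, its local
  trace on `(d i₀).φ (k i₀)` is `0` (`hvan`), the other local traces exist (dual traces transported along the local equivalences by ★
  `hasArchOpTrace_of_areUnitarilyEquivalent`, or `hvan` again), and ★ `HasLocalComponents.hasArchOpTrace_zero_of_place` concludes.
* ED. 2 (RULING R-S2-E1, 2026-09-05T03:01:08Z: print's local packets have THREE members, the assembly runs over `k : ι → Fin 3`): §2 the SAME two lemmas over the
  full-packet carrier ★ ℓ1′ `BlockPacketData β` (any finite index type `β`; `hvan` off all members) — `BlockPacketData.exists_hasArchOpTrace`,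
  `hasArchOpTrace_piPure_zero_of_not_matched_packet`; §1 (the two-member `BlockPairData` form) is unchanged and stays true.

HONESTY.  ZERO `sorry`; ★-only imports (S10 kit, ℓ3, ℓ1) + HarnessLib; no `def`, no instance, no notation; default heartbeats.  Letter-composition plumbing: the
letters ℓ3-B ∕ ℓ3-U are HYPOTHESES by name, the block-pair data is a binder — NO printed input is paid.  HC_CM is proved only modulo the 7 printed citations
(2 remaining named inputs: hLiu418 = stmt-HodgeConjecture-24832, h413 = stmt-HodgeConjecture-24833) until rung 0 closes.  Count-neutral helper.

References: [cite: Rogawski1990, §13.8 Prop. 13.8.3 (proof) p. 218 L17–19, L27–28] [cite: Dixmier1977, §13.1.3, §13.1.8] [cite: Flath1979, Thm. 1]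
-/

set_option autoImplicit false
set_option linter.dupNamespace false

noncomputable section

open MeasureTheory CompactlySupported
open scoped InnerProductSpace
open Literature.NumberTheory.Automorphic
open Summit.HodgeConjecture.HodgeConjecture.Cruxes.H413.K2E1bGKCohomologyU21.U8 (HasArchOpTrace)
open Summit.HodgeConjecture.HodgeConjecture.R90.S10 (hasArchOpTrace_of_areUnitarilyEquivalent)

namespace Summit.HodgeConjecture.HodgeConjecture.R90.S2

section Exhaust

variable {Γ : Type} [Group Γ] [TopologicalSpace Γ] [MeasurableSpace Γ] [BorelSpace Γ]
  {ι : Type} [Fintype ι] {G : ι → Type} [∀ i, Group (G i)] [∀ i, TopologicalSpace (G i)] [∀ i, MeasurableSpace (G i)] [∀ i, BorelSpace (G i)]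
  {e : Γ ≃ₜ* (∀ i, G i)} {νΓ : Measure Γ} [IsFiniteMeasureOnCompacts νΓ] {ν : ∀ i, Measure (G i)} [∀ i, IsFiniteMeasureOnCompacts (ν i)]

/-- **Local trace values of a block-pair pseudo-coefficient on ANY irreducible unitary representation of the factor**: for block-pair data `d` on `G_i` and an
irreducible unitary strongly continuous `π′` of `G_i`, each pseudo-coefficient `d.φ b′` HAS a basis-free trace on `π′` — `δ_{b b′}` if `π′ ≃ d.π b` (dual traces
`htr` transported by ★ `hasArchOpTrace_of_areUnitarilyEquivalent`), `0` if `π′` is equivalent to no member (`hvan`). [cite: Rogawski1990, §13.8 p. 218 L17–19]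
[cite: Dixmier1977, §13.1.3] -/
theorem BlockPairData.exists_hasArchOpTrace {Gw : Type} [Group Gw] [TopologicalSpace Gw] [MeasurableSpace Gw] [BorelSpace Gw] {νw : Measure Gw}
    [IsFiniteMeasureOnCompacts νw] {S : C_c(Gw, ℂ) → Prop} (d : BlockPairData Gw νw S)
    {E' : Type} [NormedAddCommGroup E'] [InnerProductSpace ℂ E'] [CompleteSpace E']
    (π' : ContRepresentation ℂ Gw E') (hu' : π'.IsUnitary) (hsc' : π'.IsStronglyContinuous) (hirr' : π'.IsTopIrreducible) (b' : Bool) :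
    ∃ t : ℂ, HasArchOpTrace νw π' hu' hsc' (d.φ b') t ∧
      ((letI := d.instNACG; letI := d.instIPS; letI := d.instCS
        ∀ b, ¬ ContRepresentation.AreUnitarilyEquivalent (d.π b) π') → t = 0) := by
  letI := d.instNACG; letI := d.instIPS; letI := d.instCS
  by_cases h : ∃ b, ContRepresentation.AreUnitarilyEquivalent (d.π b) π'
  · obtain ⟨b, hb⟩ := h
    exact ⟨if b = b' then 1 else 0, hasArchOpTrace_of_areUnitarilyEquivalent hb (d.htr b b'), fun hno => absurd hb (hno b)⟩
  · have hno : ∀ b, ¬ ContRepresentation.AreUnitarilyEquivalent (d.π b) π' := fun b hb => h ⟨b, hb⟩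
    exact ⟨0, d.hvan E' π' hu' hsc' hirr' hno b', fun _ => rfl⟩

/-- **STEP (d) OF THE T2 ASSEMBLY — TRACE `0` OUTSIDE THE TENSOR PACKET.**  Block-pair data `d i` at every factor `G_i` of `Γ ≅ ∏_i G_i` (along `e`), and for every
sign pattern `k : ι → Bool` an irreducible unitary `ϖ k` of `Γ` with local components `(d i).π (k i)` (★ `HasLocalComponents`).  Under the letters ★ `TensorRepExhausts`
(every irreducible unitary `σ` of `Γ` has irreducible unitary local components) and ★ `TensorRepUnique` (local components determine `σ` up to unitary equivalence),
every irreducible unitary strongly continuous `σ` equivalent to NO `ϖ k` has basis-free trace `0` on every pure tensor of pseudo-coefficients `⊗_i (d i).φ (k i)`: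
some local component of `σ` lies off the block pair (else ℓ3-U matches `σ` with a `ϖ b`), where the local trace vanishes, and one vanishing local trace kills the
product (★ `HasLocalComponents.hasArchOpTrace_zero_of_place`).  Print: «`Tr π(f) = 0` unless `π = ⊗_v π_{j_v v}`».
[cite: Rogawski1990, §13.8 Prop. 13.8.3 (proof) p. 218 L17–19, L27–28] [cite: Dixmier1977, §13.1.8] [cite: Flath1979, Thm. 1] -/
theorem hasArchOpTrace_piPure_zero_of_not_matched (hB : TensorRepExhausts e νΓ ν) (hU : TensorRepUnique e νΓ ν)
    {S : ∀ i, C_c(G i, ℂ) → Prop} (d : ∀ i, BlockPairData (G i) (ν i) (S i))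
    {EG : (ι → Bool) → Type} [∀ k, NormedAddCommGroup (EG k)] [∀ k, InnerProductSpace ℂ (EG k)] [∀ k, CompleteSpace (EG k)]
    (ϖ : ∀ k, ContRepresentation ℂ Γ (EG k)) (huϖ : ∀ k, (ϖ k).IsUnitary) (hscϖ : ∀ k, (ϖ k).IsStronglyContinuous)
    (hirrϖ : ∀ k, (ϖ k).IsTopIrreducible)
    (hloc : ∀ k, letI := fun i => (d i).instNACG (k i); letI := fun i => (d i).instIPS (k i); letI := fun i => (d i).instCS (k i)
      HasLocalComponents e νΓ ν (ϖ k) (huϖ k) (hscϖ k)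
        (fun i => (d i).E (k i)) (fun i => (d i).π (k i)) (fun i => (d i).hu (k i)) (fun i => (d i).hsc (k i)))
    {E' : Type} [NormedAddCommGroup E'] [InnerProductSpace ℂ E'] [CompleteSpace E']
    (σ : ContRepresentation ℂ Γ E') (hu' : σ.IsUnitary) (hsc' : σ.IsStronglyContinuous) (hirr' : σ.IsTopIrreducible)
    (hσ : ∀ k, ¬ ContRepresentation.AreUnitarilyEquivalent (ϖ k) σ) (k : ι → Bool) :
    HasArchOpTrace νΓ σ hu' hsc' (piPure e.toHomeomorph (fun i => (d i).φ (k i))) 0 := by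
  letI : ∀ i b, NormedAddCommGroup ((d i).E b) := fun i b => (d i).instNACG b
  letI : ∀ i b, InnerProductSpace ℂ ((d i).E b) := fun i b => (d i).instIPS b
  letI : ∀ i b, CompleteSpace ((d i).E b) := fun i b => (d i).instCS b
  -- ℓ3-B: `σ` has irreducible unitary local components `π'`
  obtain ⟨Eι', instN, instI, instC, π', huι', hscι', hirrι', hlocσ⟩ := hB E' σ hu' hsc' hirr'
  by_cases hall : ∀ i, ∃ b : Bool, ContRepresentation.AreUnitarilyEquivalent ((d i).π b) (π' i)
  · -- every component is a member: ℓ3-U matches `σ` with `ϖ b` — excluded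
    choose b hb using hall
    exact absurd (hU (EG b) E' (ϖ b) (huϖ b) (hscϖ b) σ hu' hsc' (fun i => (d i).E (b i)) Eι' (fun i => (d i).π (b i))
      (fun i => (d i).hu (b i)) (fun i => (d i).hsc (b i)) π' huι' hscι' (hirrϖ b) hirr' (fun i => (d i).hirr (b i)) hirrι'
      (hloc b) hlocσ hb) (hσ b)
  · -- some component `π' i₀` is off the pair: its local trace on `(d i₀).φ (k i₀)` is `0`, the others exist
    obtain ⟨i₀, hi₀⟩ := not_forall.1 hall
    have hno : ∀ b, ¬ ContRepresentation.AreUnitarilyEquivalent ((d i₀).π b) (π' i₀) := fun b hb => hi₀ ⟨b, hb⟩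
    choose t ht ht0 using fun i => (d i).exists_hasArchOpTrace (π' i) (huι' i) (hscι' i) (hirrι' i) (k i)
    exact hlocσ.hasArchOpTrace_zero_of_place (fun i => (d i).φ (k i)) t ht i₀ (ht0 i₀ hno)

end Exhaust


/-! ## §2 (ED. 2) The same over FULL local packets ★ `BlockPacketData β` (RULING R-S2-E1) -/

section ExhaustPacket

variable {Γ : Type} [Group Γ] [TopologicalSpace Γ] [MeasurableSpace Γ] [BorelSpace Γ]
  {ι : Type} [Fintype ι] {G : ι → Type} [∀ i, Group (G i)] [∀ i, TopologicalSpace (G i)] [∀ i, MeasurableSpace (G i)] [∀ i, BorelSpace (G i)]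
  {e : Γ ≃ₜ* (∀ i, G i)} {νΓ : Measure Γ} [IsFiniteMeasureOnCompacts νΓ] {ν : ∀ i, Measure (G i)} [∀ i, IsFiniteMeasureOnCompacts (ν i)]
  {β : Type} [DecidableEq β]

/-- **Local trace values of a packet pseudo-coefficient on ANY irreducible unitary representation of the factor** (full-packet carrier ★ `BlockPacketData β`):
each `d.φ b′` HAS a basis-free trace on an irreducible unitary `π′` — `δ_{b b′}` if `π′ ≃ d.π b` (★ `hasArchOpTrace_of_areUnitarilyEquivalent` on `htr`), `0` if `π′`
is equivalent to no member (`hvan`). [cite: Rogawski1990, §13.8 p. 218 L11–19] [cite: Dixmier1977, §13.1.3] -/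
theorem BlockPacketData.exists_hasArchOpTrace {Gw : Type} [Group Gw] [TopologicalSpace Gw] [MeasurableSpace Gw] [BorelSpace Gw] {νw : Measure Gw}
    [IsFiniteMeasureOnCompacts νw] {S : C_c(Gw, ℂ) → Prop} (d : BlockPacketData β Gw νw S)
    {E' : Type} [NormedAddCommGroup E'] [InnerProductSpace ℂ E'] [CompleteSpace E']
    (π' : ContRepresentation ℂ Gw E') (hu' : π'.IsUnitary) (hsc' : π'.IsStronglyContinuous) (hirr' : π'.IsTopIrreducible) (b' : β) :
    ∃ t : ℂ, HasArchOpTrace νw π' hu' hsc' (d.φ b') t ∧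
      ((letI := d.instNACG; letI := d.instIPS; letI := d.instCS
        ∀ b, ¬ ContRepresentation.AreUnitarilyEquivalent (d.π b) π') → t = 0) := by
  letI := d.instNACG; letI := d.instIPS; letI := d.instCS
  by_cases h : ∃ b, ContRepresentation.AreUnitarilyEquivalent (d.π b) π'
  · obtain ⟨b, hb⟩ := h
    exact ⟨if b = b' then 1 else 0, hasArchOpTrace_of_areUnitarilyEquivalent hb (d.htr b b'), fun hno => absurd hb (hno b)⟩
  · have hno : ∀ b, ¬ ContRepresentation.AreUnitarilyEquivalent (d.π b) π' := fun b hb => h ⟨b, hb⟩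
    exact ⟨0, d.hvan E' π' hu' hsc' hirr' hno b', fun _ => rfl⟩

/-- **STEP (d) OF THE T2 ASSEMBLY OVER FULL PACKETS — TRACE `0` OUTSIDE THE TENSOR PACKET.**  Full-packet data `d i : BlockPacketData β (G i) …` at every factor of
`Γ ≅ ∏_i G_i`, and for every member pattern `k : ι → β` an irreducible unitary `ϖ k` of `Γ` with local components `(d i).π (k i)` (★ `HasLocalComponents`).  Under
★ `TensorRepExhausts` and ★ `TensorRepUnique`, every irreducible unitary strongly continuous `σ` equivalent to NO `ϖ k` has basis-free trace `0` on every pure tensor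
`⊗_i (d i).φ (k i)` (print p. 218 L17–19 and L27–28: «`Tr π(f) = 0` unless `π = ⊗_v π_{j_v v}`»).  Same proof as §1.
[cite: Rogawski1990, §13.8 Prop. 13.8.3 (proof) p. 218 L17–19, L27–28] [cite: Dixmier1977, §13.1.8] [cite: Flath1979, Thm. 1] -/
theorem hasArchOpTrace_piPure_zero_of_not_matched_packet (hB : TensorRepExhausts e νΓ ν) (hU : TensorRepUnique e νΓ ν)
    {S : ∀ i, C_c(G i, ℂ) → Prop} (d : ∀ i, BlockPacketData β (G i) (ν i) (S i))
    {EG : (ι → β) → Type} [∀ k, NormedAddCommGroup (EG k)] [∀ k, InnerProductSpace ℂ (EG k)] [∀ k, CompleteSpace (EG k)]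
    (ϖ : ∀ k, ContRepresentation ℂ Γ (EG k)) (huϖ : ∀ k, (ϖ k).IsUnitary) (hscϖ : ∀ k, (ϖ k).IsStronglyContinuous)
    (hirrϖ : ∀ k, (ϖ k).IsTopIrreducible)
    (hloc : ∀ k, letI := fun i => (d i).instNACG (k i); letI := fun i => (d i).instIPS (k i); letI := fun i => (d i).instCS (k i)
      HasLocalComponents e νΓ ν (ϖ k) (huϖ k) (hscϖ k)
        (fun i => (d i).E (k i)) (fun i => (d i).π (k i)) (fun i => (d i).hu (k i)) (fun i => (d i).hsc (k i)))
    {E' : Type} [NormedAddCommGroup E'] [InnerProductSpace ℂ E'] [CompleteSpace E']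
    (σ : ContRepresentation ℂ Γ E') (hu' : σ.IsUnitary) (hsc' : σ.IsStronglyContinuous) (hirr' : σ.IsTopIrreducible)
    (hσ : ∀ k, ¬ ContRepresentation.AreUnitarilyEquivalent (ϖ k) σ) (k : ι → β) :
    HasArchOpTrace νΓ σ hu' hsc' (piPure e.toHomeomorph (fun i => (d i).φ (k i))) 0 := by
  letI : ∀ i b, NormedAddCommGroup ((d i).E b) := fun i b => (d i).instNACG b
  letI : ∀ i b, InnerProductSpace ℂ ((d i).E b) := fun i b => (d i).instIPS b
  letI : ∀ i b, CompleteSpace ((d i).E b) := fun i b => (d i).instCS b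
  obtain ⟨Eι', instN, instI, instC, π', huι', hscι', hirrι', hlocσ⟩ := hB E' σ hu' hsc' hirr'
  by_cases hall : ∀ i, ∃ b : β, ContRepresentation.AreUnitarilyEquivalent ((d i).π b) (π' i)
  · choose b hb using hall
    exact absurd (hU (EG b) E' (ϖ b) (huϖ b) (hscϖ b) σ hu' hsc' (fun i => (d i).E (b i)) Eι' (fun i => (d i).π (b i))
      (fun i => (d i).hu (b i)) (fun i => (d i).hsc (b i)) π' huι' hscι' (hirrϖ b) hirr' (fun i => (d i).hirr (b i)) hirrι'
      (hloc b) hlocσ hb) (hσ b)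
  · obtain ⟨i₀, hi₀⟩ := not_forall.1 hall
    have hno : ∀ b, ¬ ContRepresentation.AreUnitarilyEquivalent ((d i₀).π b) (π' i₀) := fun b hb => hi₀ ⟨b, hb⟩
    choose t ht ht0 using fun i => (d i).exists_hasArchOpTrace (π' i) (huι' i) (hscι' i) (hirrι' i) (k i)
    exact hlocσ.hasArchOpTrace_zero_of_place (fun i => (d i).φ (k i)) t ht i₀ (ht0 i₀ hno)

end ExhaustPacket

end Summit.HodgeConjecture.HodgeConjecture.R90.S2

end
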